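import Summits.BirchSwinnertonDyer.BirchSwinnertonDyer.Theses.UniversalToricDescent
import Literature.NumberTheory.EllipticCurves.AnticyclotomicPrimeDecompositionAboveProofs
import HarnessLib

/-!
# Route `UniversalToricDescent` — support leaf `BrinkPrimesAbovePNotSplitFact`
# (stmt-BirchSwinnertonDyer-20466): a tree THEOREM, by name

Seat `bsd-wall-utd-p1`, gen 5 (cell `bsd-wall`, lane 3 UTD). Leaf 6/7 of crux #5
`WildSplitControlAtThree`'s published-fact split: Brink 2007 Cor 1 — the primes of the imaginary
quadratic `K` above the odd prime `p` do not split completely in the anticyclotomic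
`ℤ_p`-extension — is the tree theorem
`Literature.NumberTheory.EllipticCurves.ZpExtension.decomp_not_le_kerSubgroup_above_of_isAnticyclotomic_holds`
(module `Literature/NumberTheory/EllipticCurves/AnticyclotomicPrimeDecompositionAboveProofs`;
candidate `exact …_holds` recorded by refuter-parity-tllh-ref-1 g1, evidence 15:15Z).
HONEST FRAMING: one token; BSD is not advanced by this.

References: [Brink2007] Cor. 1 (p. 2136); [Cox2013] Cor. 5.24, Thm. 8.10; [Washington1997] Prop. 13.2.
-/

set_option linter.dupNamespace false

namespace Summit.BirchSwinnertonDyer.BirchSwinnertonDyer.Theorems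

open Summit.BirchSwinnertonDyer.BirchSwinnertonDyer.Theses.UniversalToricDescent

/-- **Leaf `BrinkPrimesAbovePNotSplitFact` (item 20466) holds**: for every number field `K` and
prime `p`, the named fact `decomp_not_le_kerSubgroup_above_of_isAnticyclotomic K p` (Brink 2007
Cor 1: `K` imaginary quadratic, `p` odd, `κ` anticyclotomic, `v ∣ p` ⇒ `D_v ⊄ ker κ`) — the tree
theorem `decomp_not_le_kerSubgroup_above_of_isAnticyclotomic_holds`.
[cite: Brink2007, Cor. 1 (p. 2136) and its proof; §II Prop. 1 (p. 2130)] -/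
theorem brinkPrimesAbovePNotSplitFact_proof : BrinkPrimesAbovePNotSplitFact := by
  unfold BrinkPrimesAbovePNotSplitFact
  intro K _ _ p _
  exact Literature.NumberTheory.EllipticCurves.ZpExtension.decomp_not_le_kerSubgroup_above_of_isAnticyclotomic_holds
    K p

end Summit.BirchSwinnertonDyer.BirchSwinnertonDyer.Theorems
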